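import Literature.Barriers.ABC.BakerMethodBoundsStewartYuProofs
import HarnessLib

/-!
# Sub-power Stewart–Yu (crux `SubPowerStewartYu`, stmt-ABC-11053), I: routes with a distinguished prime,
accounting with slack, and the slack case

`Summits/ABC/ABC/Theorems/LogCardinalitySubPowerStewartYuRoutes.lean` — first helper file toward
`Summit.ABC.ABC.Theses.LogCardinality.SubPowerStewartYu` (route `LogCardinality`, crux rank 3):
`log c ≤ κ · R^{1/3} · exp(−c₀ log R / log log R)` for all abc triples with `R = rad(abc) ≥ R₀`, from
Pasten's form of the linear-forms bounds (inlined hypothesis) and Yu's 2013 `p`-adic bound (inlined).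

The proof runs the three-routes accounting of `Literature.Barriers.ABC.BakerMethodBoundsThreeRoutesProofs`
(Stewart–Yu 2001, Theorem 1, as reconstructed there) but KEEPS the slack that the accounting throws
away. For a member `w` with prime set `S`, top prime `P = max(1, max S)` and tail `T = S ∖ {P}`, the
accounting bounds `K^{2|S|} (∏_S log q)² (1 + 3 s)` by `4K²Λ² · X · J_T` whenever `1 + 3 s ≤ 4^{|S|} X`,
where `J_T = ∏_{q ∈ T} 4K²(log q)²` is the *junk factor* (`member_accounting_gen`); the classical
accounting then spends `J_T ≤ C · ∏_T q`. This file provides: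

* the routes through `a` and through `c` with ONE prime `P` left unestimated
  (`log_lt_route_a_erase`, `log_lt_route_c_erase`), so that a sharper bound (Yu 2013 with Stewart's
  inflation, later files) can be inserted at the top prime;
* the accounting with slack (`member_accounting_gen`) and the elementary facts about tops and tails
  (`prod_eq_top_mul_prod_erase`, `one_add_three_mul_sum_le_pow_mul_top`,
  `one_add_three_mul_sum_le_pow_mul_prod`, `card_mul_log_two_le_log_prod`);
* the junk bound `∏_T 4K²(log q)² ≤ D · (∏_T q)^{1/2}` (`exists_prod_mul_log_sq_le_mul_sqrt_prod`),
  which makes a member with small slack *top-heavy* (`prod_erase_lt_of_slack_lt`).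

[cite: StewartYu2001, Theorem 1 (proof scheme)]; the inflation device is [cite: Stewart2013, Lemma 8].
No new definitions; all objects are spelled out.
-/

noncomputable section

-- `Summit.ABC.ABC.…` is the tree's namespace convention for this sub-problem (summit = problem).
set_option linter.dupNamespace false

open Finset Real Height
open Literature.NumberTheory.DiophantineGeometry
open Literature.NumberTheory.DiophantineGeometry.Dioph
open Literature.NumberTheory.DiophantineGeometry.Pasten
open Literature.Barriers.ABC

namespace Summit.ABC.ABC.Theorems.SubPowerSY

/-! ### Routes with one prime left unestimated -/

section Routes

variable {a b c : ℕ} {K : ℝ}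

/-- **Route through `a` with the prime `P ∣ a` left unestimated**: with `Θ_{bc} = theta K b c 0` and
`Y = log max{e, 2 log c}`, `log c < Θ_{bc} · Y · (1 + 3 ∑_{p ∣ a, p ≠ P} p) + ν_P(a) · log P`
(archimedean place + Pasten's `p`-adic clause at the primes `p ≠ P` of `a`).
[cite: StewartYu2001, §3 (proof scheme), as reconstructed in BakerMethodBoundsThreeRoutesProofs] -/
theorem log_lt_route_a_erase (hK : 1 ≤ K) (hP : PastenApproximationBound K) (h : IsABCTriple a b c)
    {P : ℕ} (hPa : P ∈ a.primeFactors) :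
    Real.log c < theta K b c 0 * Real.log (max (Real.exp 1) (2 * Real.log c)) *
      (1 + 3 * ∑ p ∈ a.primeFactors.erase P, (p : ℝ)) + (a.factorization P : ℝ) * Real.log P := by
  obtain ⟨ha, hb, habc, hcop⟩ := id h
  set Θ := theta K b c 0 with hΘ
  set Y := Real.log (max (Real.exp 1) (2 * Real.log c)) with hY
  have hY1 : 1 ≤ Y := one_le_log_max_exp _
  have hΘ0 : 0 ≤ Θ := theta_nonneg (zero_le_one.trans hK) b c 0
  have harch : Real.log c - Real.log a < Θ * Y := arch_bound hK hP h 0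
  have hloga : Real.log a = ∑ p ∈ a.primeFactors, (a.factorization p : ℝ) * Real.log p :=
    log_eq_sum_factorization_mul_log ha.ne'
  rw [← Finset.add_sum_erase _ _ hPa] at hloga
  have hsum : ∑ p ∈ a.primeFactors.erase P, (a.factorization p : ℝ) * Real.log p ≤
      ∑ p ∈ a.primeFactors.erase P, Θ * (3 * p * Y) := by
    refine Finset.sum_le_sum fun p hp => ?_
    have hp0 := Finset.mem_of_mem_erase hp
    have hp' := Nat.prime_of_mem_primeFactors hp0
    have hpa := Nat.dvd_of_mem_primeFactors hp0
    have h1 := padic_bound_a hK hP h 0 hp' hpa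
    have h2 : (p : ℝ) / Real.log p * (Real.log p + Y) ≤ 3 * p * Y :=
      div_log_mul_add_le (by exact_mod_cast hp'.two_le) hY1
    exact (h1.trans_le (mul_le_mul_of_nonneg_left h2 hΘ0)).le
  have hsum' : ∑ p ∈ a.primeFactors.erase P, Θ * (3 * p * Y) =
      Θ * Y * (3 * ∑ p ∈ a.primeFactors.erase P, (p : ℝ)) := by
    rw [Finset.mul_sum, Finset.mul_sum]
    exact Finset.sum_congr rfl fun p _ => by ring
  have hloga' : Real.log a ≤ (a.factorization P : ℝ) * Real.log P +
      Θ * Y * (3 * ∑ p ∈ a.primeFactors.erase P, (p : ℝ)) := by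
    rw [hloga, ← hsum']
    exact add_le_add le_rfl hsum
  calc Real.log c = (Real.log c - Real.log a) + Real.log a := by ring
    _ < Θ * Y + ((a.factorization P : ℝ) * Real.log P +
        Θ * Y * (3 * ∑ p ∈ a.primeFactors.erase P, (p : ℝ))) := add_lt_add_of_lt_of_le harch hloga'
    _ = Θ * Y * (1 + 3 * ∑ p ∈ a.primeFactors.erase P, (p : ℝ)) +
        (a.factorization P : ℝ) * Real.log P := by ring

/-- **Route through `c` with the prime `P ∣ c` left unestimated** (needs `ab > 1`):
`log c < Θ_{ab} · Y · (1 + 3 ∑_{p ∣ c, p ≠ P} p) + ν_P(c) · log P`.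
[cite: StewartYu2001, §3 (proof scheme), as reconstructed in BakerMethodBoundsThreeRoutesProofs] -/
theorem log_lt_route_c_erase (hK : 1 ≤ K) (hP : PastenApproximationBound K) (h : IsABCTriple a b c)
    (h1 : 1 < a * b) {P : ℕ} (hPc : P ∈ c.primeFactors) :
    Real.log c < theta K a b 0 * Real.log (max (Real.exp 1) (2 * Real.log c)) *
      (1 + 3 * ∑ p ∈ c.primeFactors.erase P, (p : ℝ)) + (c.factorization P : ℝ) * Real.log P := by
  obtain ⟨ha, hb, habc, hcop⟩ := id h
  set Θ := theta K a b 0 with hΘ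
  set Y := Real.log (max (Real.exp 1) (2 * Real.log c)) with hY
  have hc : c ≠ 0 := by omega
  have hY1 : 1 ≤ Y := one_le_log_max_exp _
  have hΘpos : 0 < Θ := theta_zero_pos hK ha.ne' hb.ne' hcop
  have hΘ0 : 0 ≤ Θ := hΘpos.le
  have hlogc : Real.log c = ∑ p ∈ c.primeFactors, (c.factorization p : ℝ) * Real.log p :=
    log_eq_sum_factorization_mul_log hc
  rw [← Finset.add_sum_erase _ _ hPc] at hlogc
  have hsum : ∑ p ∈ c.primeFactors.erase P, (c.factorization p : ℝ) * Real.log p ≤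
      ∑ p ∈ c.primeFactors.erase P, Θ * (3 * p * Y) := by
    refine Finset.sum_le_sum fun p hp => ?_
    have hp0 := Finset.mem_of_mem_erase hp
    have hp' := Nat.prime_of_mem_primeFactors hp0
    have hpc := Nat.dvd_of_mem_primeFactors hp0
    have h1' := padic_bound_c hK hP h h1 0 hp' hpc
    have h2 : (p : ℝ) / Real.log p * (Real.log p + Y) ≤ 3 * p * Y :=
      div_log_mul_add_le (by exact_mod_cast hp'.two_le) hY1
    exact (h1'.trans_le (mul_le_mul_of_nonneg_left h2 hΘ0)).le
  have hsum' : ∑ p ∈ c.primeFactors.erase P, Θ * (3 * p * Y) =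
      Θ * Y * (3 * ∑ p ∈ c.primeFactors.erase P, (p : ℝ)) := by
    rw [Finset.mul_sum, Finset.mul_sum]
    exact Finset.sum_congr rfl fun p _ => by ring
  have hΘY : 0 < Θ * Y := mul_pos hΘpos (lt_of_lt_of_le one_pos hY1)
  calc Real.log c = (c.factorization P : ℝ) * Real.log P +
        ∑ p ∈ c.primeFactors.erase P, (c.factorization p : ℝ) * Real.log p := hlogc
    _ ≤ (c.factorization P : ℝ) * Real.log P +
        Θ * Y * (3 * ∑ p ∈ c.primeFactors.erase P, (p : ℝ)) := by
        rw [← hsum']; exact add_le_add le_rfl hsum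
    _ < Θ * Y + ((c.factorization P : ℝ) * Real.log P +
        Θ * Y * (3 * ∑ p ∈ c.primeFactors.erase P, (p : ℝ))) := by linarith
    _ = Θ * Y * (1 + 3 * ∑ p ∈ c.primeFactors.erase P, (p : ℝ)) +
        (c.factorization P : ℝ) * Real.log P := by ring

end Routes

/-! ### Tops and tails of a finite set of primes

Throughout, the *top* of a finite set `S ⊆ ℕ` is `max 1 (S.sup id)` (the largest element, or `1` if
`S = ∅`) and the *tail* is `S.erase (max 1 (S.sup id))`. -/

section TopTail

variable (S : Finset ℕ)

/-- Every element of `S` is at most the top. [folklore] -/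
theorem le_top_of_mem {q : ℕ} (hq : q ∈ S) : q ≤ max 1 (S.sup id) :=
  le_trans (Finset.le_sup (f := id) hq) (le_max_right _ _)

/-- The top of a nonempty set of positive numbers belongs to it. [folklore] -/
theorem top_mem (hne : S.Nonempty) (hpos : ∀ q ∈ S, 1 ≤ q) : max 1 (S.sup id) ∈ S := by
  obtain ⟨q, hq, hsup⟩ := Finset.exists_mem_eq_sup S hne id
  have h1 : 1 ≤ S.sup id := by rw [hsup]; exact hpos q hq
  rw [max_eq_right h1, hsup]
  exact hq

/-- The top of the empty set is `1`. [folklore] -/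
theorem top_empty : max 1 ((∅ : Finset ℕ).sup id) = 1 := by simp

/-- `∏_S q = top · ∏_{tail} q` (also for `S = ∅`). [folklore] -/
theorem prod_eq_top_mul_prod_erase (hpos : ∀ q ∈ S, 1 ≤ q) :
    ∏ q ∈ S, (q : ℝ) = (max 1 (S.sup id) : ℕ) * ∏ q ∈ S.erase (max 1 (S.sup id)), (q : ℝ) := by
  rcases S.eq_empty_or_nonempty with rfl | hne
  · simp
  · exact (Finset.mul_prod_erase S (fun q => ((q : ℕ) : ℝ)) (top_mem S hne hpos)).symm

/-- `|S| ≤ |tail| + 1`. [folklore] -/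
theorem card_le_card_erase_add_one : S.card ≤ (S.erase (max 1 (S.sup id))).card + 1 := by
  have := Finset.pred_card_le_card_erase (s := S) (a := max 1 (S.sup id))
  omega

/-- `1 + 3 ∑_S q ≤ 4^{|S|} · top`. [folklore] -/
theorem one_add_three_mul_sum_le_pow_mul_top :
    (1 : ℝ) + 3 * ∑ q ∈ S, (q : ℝ) ≤ 4 ^ S.card * (max 1 (S.sup id) : ℕ) := by
  set P : ℕ := max 1 (S.sup id) with hP
  have hP1 : (1 : ℝ) ≤ P := by exact_mod_cast le_max_left 1 (S.sup id)
  have h1 : ∑ q ∈ S, (q : ℝ) ≤ S.card * (P : ℝ) := by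
    have := Finset.sum_le_card_nsmul S (fun q => ((q : ℕ) : ℝ)) P
      (fun q hq => by exact_mod_cast le_top_of_mem S hq)
    rwa [nsmul_eq_mul] at this
  have h2 := one_add_three_mul_le_four_pow S.card
  have h3 : (0 : ℝ) ≤ 3 * S.card := by positivity
  calc (1 : ℝ) + 3 * ∑ q ∈ S, (q : ℝ) ≤ 1 + 3 * (S.card * P) := by linarith
    _ ≤ (1 + 3 * S.card) * P := by nlinarith
    _ ≤ 4 ^ S.card * P := mul_le_mul_of_nonneg_right h2 (by linarith)

/-- `1 + 3 ∑_T q ≤ 4^{|T|} · ∏_T q` for a finite set `T` of positive integers. [folklore] -/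
theorem one_add_three_mul_sum_le_pow_mul_prod (T : Finset ℕ) (hpos : ∀ q ∈ T, 1 ≤ q) :
    (1 : ℝ) + 3 * ∑ q ∈ T, (q : ℝ) ≤ 4 ^ T.card * ∏ q ∈ T, (q : ℝ) := by
  classical
  induction T using Finset.induction_on with
  | empty => simp
  | insert x T hx ih =>
    have hx1 : (1 : ℝ) ≤ x := by exact_mod_cast hpos x (Finset.mem_insert_self x T)
    have hT : ∀ q ∈ T, 1 ≤ q := fun q hq => hpos q (Finset.mem_insert_of_mem hq)
    have ih' := ih hT
    have hprod1 : (1 : ℝ) ≤ ∏ q ∈ T, (q : ℝ) :=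
      Finset.one_le_prod fun q hq => by exact_mod_cast hT q hq
    have h4 : (1 : ℝ) ≤ 4 ^ T.card := one_le_pow₀ (by norm_num)
    rw [Finset.sum_insert hx, Finset.prod_insert hx, Finset.card_insert_of_notMem hx, pow_succ]
    have hX : (1 : ℝ) ≤ 4 ^ T.card * ∏ q ∈ T, (q : ℝ) := one_le_mul_of_one_le_of_one_le h4 hprod1
    nlinarith [mul_nonneg (sub_nonneg.2 hX) (sub_nonneg.2 hx1)]

/-- `|T| · log 2 ≤ log ∏_T q` for a finite set `T` of integers `≥ 2`. [folklore] -/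
theorem card_mul_log_two_le_log_prod (T : Finset ℕ) (h2 : ∀ q ∈ T, 2 ≤ q) :
    (T.card : ℝ) * Real.log 2 ≤ Real.log (∏ q ∈ T, (q : ℝ)) := by
  have hpos : ∀ q ∈ T, (0 : ℝ) < q := fun q hq => by
    have := h2 q hq; exact_mod_cast (show 0 < q by omega)
  rw [Real.log_prod (s := T) (f := fun q => ((q : ℕ) : ℝ)) (fun q hq => (hpos q hq).ne')]
  have := Finset.card_nsmul_le_sum T (fun q => Real.log ((q : ℕ) : ℝ)) (Real.log 2)
    (fun q hq => Real.log_le_log two_pos (by exact_mod_cast h2 q hq))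
  rwa [nsmul_eq_mul] at this

end TopTail

/-! ### Accounting with slack -/

section Accounting

variable {K : ℝ}

/-- **Per-member accounting with the slack kept.** For a finite set `S` of primes all `≤ e^{Λ}`
(`Λ ≥ 1`), `K ≥ 1`, top `P = max(1, max S)`, tail `T = S ∖ {P}`, and any `s`, `X ≥ 0` with
`1 + 3 s ≤ 4^{|S|} X`:
`K^{2|S|} (∏_S log q)² (1 + 3 s) ≤ 4K² Λ² · X · ∏_{T} 4K²(log q)²`.
(The classical accounting `member_accounting` is the case `X = P`, `s = ∑_S q`, followed by
`∏_T 4K²(log q)² ≤ C ∏_T q`.) [folklore] -/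
theorem member_accounting_gen (hK : 1 ≤ K) {Λ : ℝ} (hΛ : 1 ≤ Λ) (S : Finset ℕ)
    (hS : ∀ p ∈ S, p.Prime) (hSΛ : ∀ p ∈ S, Real.log p ≤ Λ) {s X : ℝ} (hX : 0 ≤ X)
    (hs : 1 + 3 * s ≤ 4 ^ S.card * X) :
    K ^ (2 * S.card) * (∏ p ∈ S, Real.log p) ^ 2 * (1 + 3 * s) ≤
      4 * K ^ 2 * Λ ^ 2 * X * ∏ p ∈ S.erase (max 1 (S.sup id)), (4 * K ^ 2 * Real.log p ^ 2) := by
  classical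
  have hK0 : 0 ≤ K := zero_le_one.trans hK
  have hlog0 : ∀ p ∈ S, 0 ≤ Real.log p := fun p hp =>
    Real.log_nonneg (by exact_mod_cast (hS p hp).one_lt.le)
  rcases S.eq_empty_or_nonempty with rfl | hne
  · simp only [Finset.card_empty, mul_zero, pow_zero, Finset.prod_empty, one_pow, one_mul,
      Finset.sup_empty, Finset.erase_empty, mul_one]
    simp only [Finset.card_empty, pow_zero, one_mul] at hs
    have h4 : (1 : ℝ) ≤ 4 * K ^ 2 * Λ ^ 2 := by nlinarith [one_le_pow₀ (n := 2) hΛ]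
    calc (1 : ℝ) + 3 * s ≤ X := hs
      _ = 1 * X := (one_mul X).symm
      _ ≤ 4 * K ^ 2 * Λ ^ 2 * X := mul_le_mul_of_nonneg_right h4 hX
  · set P : ℕ := max 1 (S.sup id) with hPdef
    have hPS : P ∈ S := top_mem S hne fun q hq => (hS q hq).one_lt.le
    set T := S.erase P with hT
    have hcard : S.card = T.card + 1 := (Finset.card_erase_add_one hPS).symm
    have hprodlog : ∏ p ∈ S, Real.log p = Real.log P * ∏ p ∈ T, Real.log p :=
      (Finset.mul_prod_erase S (fun p => Real.log (p : ℝ)) hPS).symm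
    have hlogP : Real.log P ^ 2 ≤ Λ ^ 2 := pow_le_pow_left₀ (hlog0 P hPS) (hSΛ P hPS) 2
    have hsplit : K ^ (2 * S.card) * (∏ p ∈ S, Real.log p) ^ 2 * (4 ^ S.card * X) =
        4 * K ^ 2 * Real.log P ^ 2 * X * ∏ p ∈ T, (4 * K ^ 2 * Real.log p ^ 2) := by
      rw [hprodlog, hcard, Finset.prod_mul_distrib, Finset.prod_const, Finset.prod_pow]
      ring
    have hLHS0 : 0 ≤ K ^ (2 * S.card) * (∏ p ∈ S, Real.log p) ^ 2 := by positivity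
    have htail0 : 0 ≤ ∏ p ∈ T, (4 * K ^ 2 * Real.log p ^ 2) :=
      Finset.prod_nonneg fun p hp => by
        have := hlog0 p (Finset.mem_of_mem_erase hp); positivity
    calc K ^ (2 * S.card) * (∏ p ∈ S, Real.log p) ^ 2 * (1 + 3 * s)
        ≤ K ^ (2 * S.card) * (∏ p ∈ S, Real.log p) ^ 2 * (4 ^ S.card * X) :=
          mul_le_mul_of_nonneg_left hs hLHS0
      _ = 4 * K ^ 2 * Real.log P ^ 2 * X * ∏ p ∈ T, (4 * K ^ 2 * Real.log p ^ 2) := hsplit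
      _ ≤ 4 * K ^ 2 * Λ ^ 2 * X * ∏ p ∈ T, (4 * K ^ 2 * Real.log p ^ 2) := by
          apply mul_le_mul_of_nonneg_right _ htail0
          apply mul_le_mul_of_nonneg_right _ hX
          exact mul_le_mul_of_nonneg_left hlogP (by positivity)

/-- The junk factor of a tail is paid by the tail's radical: `∏_T 4K²(log q)² ≤ C · ∏_T q`, where
`C` bounds the products `∏ 4K²(log q)²/q` over finite sets of primes. [folklore] -/
theorem prod_mul_log_sq_le_mul_prod {C : ℝ}
    (hC : ∀ S : Finset ℕ, (∀ p ∈ S, p.Prime) → ∏ p ∈ S, 4 * K ^ 2 * Real.log p ^ 2 / p ≤ C)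
    (T : Finset ℕ) (hT : ∀ p ∈ T, p.Prime) :
    ∏ p ∈ T, (4 * K ^ 2 * Real.log p ^ 2) ≤ C * ∏ p ∈ T, (p : ℝ) := by
  have hTpos : 0 < ∏ p ∈ T, (p : ℝ) := Finset.prod_pos fun p hp => by exact_mod_cast (hT p hp).pos
  have h := hC T hT
  rw [Finset.prod_div_distrib, div_le_iff₀ hTpos] at h
  exact h

/-- **Primes beat `A (log q)²` even against `√q`.** For `A ≥ 0` there is `D ≥ 1` with
`∏_{q ∈ T} A (log q)² ≤ D · (∏_{q ∈ T} q)^{1/2}` for every finite set `T` of primes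
(indeed `A(log q)² = 4A (log √q)² ≤ √q` once `√q ≥ 256 · 16 A²`). [folklore] -/
theorem exists_prod_mul_log_sq_le_mul_sqrt_prod {A : ℝ} (hA : 0 ≤ A) :
    ∃ D : ℝ, 1 ≤ D ∧ ∀ T : Finset ℕ, (∀ p ∈ T, p.Prime) →
      ∏ p ∈ T, A * Real.log p ^ 2 ≤ D * Real.sqrt (∏ p ∈ T, (p : ℝ)) := by
  classical
  set N : ℕ := ⌈(256 * (4 * A) ^ 2) ^ 2⌉₊ with hN
  set f : ℕ → ℝ := fun p => A * Real.log p ^ 2 / Real.sqrt p with hf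
  set D : ℝ := ∏ p ∈ (Finset.range N).filter Nat.Prime, max 1 (f p) with hD
  have hD1 : 1 ≤ D := Finset.one_le_prod fun p _ => le_max_left _ _
  refine ⟨D, hD1, fun T hT => ?_⟩
  have hf0 : ∀ p ∈ T, 0 ≤ f p := fun p hp => by
    have := (hT p hp).pos
    positivity
  -- pointwise: `f p ≤ 1` for `p ≥ N`, `f p ≤ max 1 (f p)` always
  have hlarge : ∀ p ∈ T, ¬p < N → f p ≤ 1 := by
    intro p hp hpN
    have hp1 : (1 : ℝ) ≤ p := by exact_mod_cast (hT p hp).one_lt.le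
    have hp0 : (0 : ℝ) ≤ p := by linarith
    have hpN' : (256 * (4 * A) ^ 2) ^ 2 ≤ (p : ℝ) :=
      (Nat.le_ceil _).trans (by exact_mod_cast not_lt.mp hpN)
    have hsqrt1 : 1 ≤ Real.sqrt p := by
      rw [show (1 : ℝ) = Real.sqrt 1 by simp]; exact Real.sqrt_le_sqrt hp1
    have hsqrtN : 256 * (4 * A) ^ 2 ≤ Real.sqrt p := by
      rw [Real.le_sqrt (by positivity) hp0]; exact hpN'
    have key := mul_log_sq_le_self (A := 4 * A) (p := Real.sqrt p) (by positivity) hsqrt1 hsqrtN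
    have hlog : Real.log p = 2 * Real.log (Real.sqrt p) := by
      conv_lhs => rw [← Real.mul_self_sqrt hp0]
      rw [Real.log_mul (by positivity) (by positivity)]; ring
    rw [hf]; dsimp only
    rw [div_le_one (by positivity), hlog]
    nlinarith [sq_nonneg (Real.log (Real.sqrt p))]
  -- the product over `T` equals `(∏ f) * √(∏ p)`
  have hsqrt_prod : Real.sqrt (∏ p ∈ T, (p : ℝ)) = ∏ p ∈ T, Real.sqrt p := by
    rw [Real.sqrt_eq_rpow, ← Real.finsetProd_rpow _ _ (fun p hp => by exact_mod_cast (hT p hp).pos.le)]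
    exact Finset.prod_congr rfl fun p _ => (Real.sqrt_eq_rpow _).symm
  have hsplit : ∏ p ∈ T, A * Real.log p ^ 2 = (∏ p ∈ T, f p) * ∏ p ∈ T, Real.sqrt p := by
    rw [← Finset.prod_mul_distrib]
    refine Finset.prod_congr rfl fun p hp => ?_
    have : 0 < Real.sqrt p := Real.sqrt_pos.2 (by exact_mod_cast (hT p hp).pos)
    rw [hf]; dsimp only; field_simp
  rw [hsplit, hsqrt_prod]
  apply mul_le_mul_of_nonneg_right _ (Finset.prod_nonneg fun p _ => Real.sqrt_nonneg _)
  -- `∏_T f ≤ D`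
  rw [← Finset.prod_filter_mul_prod_filter_not T (fun p => p < N)]
  have hsmall : ∏ p ∈ T.filter (fun p => p < N), f p ≤ D := by
    calc ∏ p ∈ T.filter (fun p => p < N), f p
        ≤ ∏ p ∈ T.filter (fun p => p < N), max 1 (f p) :=
          Finset.prod_le_prod (fun p hp => hf0 p (Finset.mem_filter.mp hp).1)
            fun p _ => le_max_right _ _
      _ ≤ D := by
          apply Finset.prod_le_prod_of_subset_of_one_le
          · intro p hp
            obtain ⟨hpT, hpN⟩ := Finset.mem_filter.mp hp
            exact Finset.mem_filter.mpr ⟨Finset.mem_range.mpr hpN, hT p hpT⟩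
          · intro p _; exact zero_le_one.trans (le_max_left _ _)
          · intro p _ _; exact le_max_left _ _
  have hlarge' : ∏ p ∈ T.filter (fun p => ¬p < N), f p ≤ 1 :=
    Finset.prod_le_one (fun p hp => hf0 p (Finset.mem_filter.mp hp).1) fun p hp =>
      hlarge p (Finset.mem_filter.mp hp).1 (Finset.mem_filter.mp hp).2
  have h0 : 0 ≤ ∏ p ∈ T.filter (fun p => ¬p < N), f p :=
    Finset.prod_nonneg fun p hp => hf0 p (Finset.mem_filter.mp hp).1
  calc (∏ p ∈ T.filter (fun p => p < N), f p) * ∏ p ∈ T.filter (fun p => ¬p < N), f p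
      ≤ D * 1 := mul_le_mul hsmall hlarge' h0 (zero_le_one.trans hD1)
    _ = D := mul_one D

/-- **Small slack makes a member top-heavy.** If the junk factor of a tail `T` of primes satisfies
`∏_T 4K²(log q)² ≤ D (∏_T q)^{1/2}` and the slack is small, `∏_T q < (∏_T 4K²(log q)²) · E`
(`E > 0`), then `∏_T q < D² E²`. [folklore] -/
theorem prod_lt_of_slack_lt {D E : ℝ} (hE : 0 < E) (T : Finset ℕ)
    (hT : ∀ p ∈ T, p.Prime)
    (hJ : ∏ p ∈ T, (4 * K ^ 2 * Real.log p ^ 2) ≤ D * Real.sqrt (∏ p ∈ T, (p : ℝ)))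
    (hslack : ∏ p ∈ T, (p : ℝ) < (∏ p ∈ T, (4 * K ^ 2 * Real.log p ^ 2)) * E) :
    ∏ p ∈ T, (p : ℝ) < D ^ 2 * E ^ 2 := by
  set r := ∏ p ∈ T, (p : ℝ) with hr
  have hrpos : 0 < r := Finset.prod_pos fun p hp => by exact_mod_cast (hT p hp).pos
  have hs : Real.sqrt r * Real.sqrt r = r := Real.mul_self_sqrt hrpos.le
  have hspos : 0 < Real.sqrt r := Real.sqrt_pos.2 hrpos
  have h1 : r < D * Real.sqrt r * E := lt_of_lt_of_le hslack (mul_le_mul_of_nonneg_right hJ hE.le)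
  have h2 : Real.sqrt r < D * E := by
    by_contra h
    push Not at h
    have : D * Real.sqrt r * E ≤ Real.sqrt r * Real.sqrt r := by
      calc D * Real.sqrt r * E = (D * E) * Real.sqrt r := by ring
        _ ≤ Real.sqrt r * Real.sqrt r := mul_le_mul_of_nonneg_right h hspos.le
    linarith
  calc r = Real.sqrt r * Real.sqrt r := hs.symm
    _ < (D * E) * (D * E) := mul_lt_mul'' h2 h2 hspos.le hspos.le
    _ = D ^ 2 * E ^ 2 := by ring

end Accounting

end Summit.ABC.ABC.Theorems.SubPowerSY

end
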